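import Summits.QuantumFields.YangMills.Theorems.FluctuationComparisonRegPrIntLS2BetaChartContCovariancePointwise
import HarnessLib

/-!
# CHART∞ · V-e1 (LINE g18-1 `semiclassical_s2beta`, organ S2β, LAPLACE row): THE WINDOW GRAPH IS A NEIGHBOURHOOD OF EVERY SELF-LIVE STRICT POINT

R3 = Bałaban's UV-stability programme on the finite 3-torus, gauge group `SU(N)` (generic `(P, N)` here) — NOT d = 4, NOT infinite volume, NOT a mass gap,
NOT Clay; the Yang–Mills gap is NOT proved by anything in this file.  Helper toward crux `stmt-QuantumFields-20520` (`FluctuationComparisonRegPrIntL`),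
LINE g18-1, LAPLACE row, letter CHART∞ (V) «docking edition», part (e): the LOCAL transversal row `∀ᶠ y in 𝓝 0, σ y ∈ Xc` of LIMIT-INST (w5-20520 g14's
`…S2BetaLaplaceInstLocal`) needs the carrier `Xc = {c.jac (V,·) ≠ 0}` to be a NEIGHBOURHOOD of the minimiser `U₀ = σ 0`.
* ★ `chainWindow_mem_nhds` — for a field `U₀` with STRICT small loop history below level `n`, the iterated-window graph `{(z, g) | g ∈ chainWindow α n z c}` is a
  neighbourhood of `(U₀, U₀ (βₙ c))` (induction through ✓`chainWindow_succ`: the level-`n` window condition at the own pivot value is the strict loop inequality of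
  `Ū⁽ⁿ⁾ U₀`, a `<`-condition on a function continuous there — ✓`continuousAt_chainStepArg₂`, ✓`continuous_fibreFamily₂`, ✓`loopHol_update_centralBond_self`);
* ★★ `graph_mem_nhds` — for such `U₀`, the window graph over its own average, `{z | ∀ c, (Ū⁽ⁿ⁾ U₀) c ∈ T c z}`, is a neighbourhood of `U₀`: w3-20520 g13's parametric
  open mapping ✓`map_nhds_iterExtend_eq` («`(z, g) ↦ (z, Ū⁽ⁿ⁾(z[βₙ ↦ g]))` maps `𝓝 (U₀, U₀ ∘ βₙ)` onto `𝓝 (U₀, Ū⁽ⁿ⁾ U₀)`») applied to the window-graph neighbourhood,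
  then RECOGNITION (conjunct (13)).
[cite: Balaban1987RG1, (0.4) p.253, (2.9) p.266 and (2.10) p.267; Balaban1985Averaging, Prop. 3 (124) p.36]
-/

noncomputable section

open MeasureTheory Filter Topology Set
open scoped ENNReal NNReal
open Literature.MathematicalPhysics.QuantumFieldTheory.Balaban1983to89
open Literature.MathematicalPhysics.QuantumFieldTheory.Balaban1983to89.T4Continuum

namespace Summit.QuantumFields.YangMills.Theorems.FluctuationComparisonRegPrIntLS2BetaChartContCarrierNhds

open Summit.QuantumFields.YangMills.Theorems.FluctuationComparisonRegPrIntLWregChain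
open Summit.QuantumFields.YangMills.Theorems.FluctuationComparisonRegPrIntLWregFibredChart
open Summit.QuantumFields.YangMills.Theorems.FluctuationComparisonRegPrIntLWregChartCharge (map_nhds_iterExtend_eq)
open Summit.QuantumFields.YangMills.Theorems.FluctuationComparisonRegPrIntLWregChartChargeOneStep (continuous_fibreFamily₂)
open Summit.QuantumFields.YangMills.Theorems.FluctuationComparisonRegPrIntLS2BetaChartContChainCharts (continuousAt_chainStepArg₂)
open Summit.QuantumFields.YangMills.Theorems.FluctuationComparisonRegPrIntLS2BetaChartContCovariancePointwise (mem_chartWindowSet_of_loopSmall)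
open Function
open Literature.MathematicalPhysics.QuantumFieldTheory.Balaban1983to89.BlockAveraging (Idx loopHol)
open Literature.MathematicalPhysics.QuantumFieldTheory.Balaban1983to89.BlockAveragingHaarAC (centralBond pre post)
open Literature.MathematicalPhysics.QuantumFieldTheory.Balaban1983to89.BlockAveragingEMLHaarAC (fibreFamily loopHol_update_centralBond_self)
open Literature.MathematicalPhysics.QuantumFieldTheory.Balaban1983to89.ExpMeanLog (expMeanLogSU deltaSU)
open Literature.MathematicalPhysics.QuantumFieldTheory.Balaban1983to89.Node00 (SU)

variable {P : Params} {N : ℕ} [NeZero N]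

/-- ★ **THE ITERATED-WINDOW GRAPH IS A NEIGHBOURHOOD OF `(U₀, U₀ (βₙ c))`** for a field `U₀` with strict small loop history below level `n`.
[cite: Balaban1987RG1, (0.4) p.253 and (2.9) p.266] -/
theorem chainWindow_mem_nhds {α : ℝ} (hαδ : α < deltaSU (Fin N)) :
    ∀ {n : ℕ}, n ≤ P.m + P.K → ∀ (c : PBond P n) (U₀ : GaugeField P 0 (SU N)),
      (∀ k, k < n → ∀ (c' : PBond P (k + 1)) (i : Idx P),
        dist1 (loopHol (Averaging.iter (fun i => BlockAveraging.blockAvg (P := P) (j := i) (expMeanLogSU (n := Fin N))) k U₀) c' i) < α) →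
      {q : GaugeField P 0 (SU N) × SU N | q.2 ∈ chainWindow (N := N) α n q.1 c} ∈ 𝓝 ((U₀, U₀ (iterCentralBond n c)) : GaugeField P 0 (SU N) × SU N)
  | 0, _ => fun _ _ _ => univ_mem' fun _ => mem_univ _
  | n + 1, hn => fun c U₀ hstrict => by
      classical
      have IH := chainWindow_mem_nhds hαδ (n := n) (by omega) (centralBond c) U₀ fun k hk => hstrict k (by omega)
      have hsmall : ∀ k, k < n → ∀ (c' : PBond P (k + 1)) (i : Idx P),
          dist1 (loopHol (Averaging.iter (fun i => BlockAveraging.blockAvg (P := P) (j := i) (expMeanLogSU (n := Fin N))) k U₀) c' i) ≤ α :=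
        fun k hk c' i => (hstrict k (by omega) c' i).le
      have hg₀ : U₀ (iterCentralBond n (centralBond c)) ∈ chainWindow (N := N) α n U₀ (centralBond c) :=
        mem_chartWindowSet_of_loopSmall (P := P) (N := N) (by omega) U₀ hsmall (centralBond c)
      -- the level-`n` condition is a strict inequality at the own pivot value, on a function continuous there
      have hstep := continuousAt_chainStepArg₂ (P := P) (N := N) hαδ (by omega) c U₀ (U₀ (iterCentralBond n (centralBond c))) hsmall hg₀
      have hval : ∀ i : Idx P, dist1 (fibreFamily
          (Averaging.iter (fun i => BlockAveraging.blockAvg (P := P) (j := i) (expMeanLogSU (n := Fin N))) n U₀) c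
          (pre (Averaging.iter (fun i => BlockAveraging.blockAvg (P := P) (j := i) (expMeanLogSU (n := Fin N))) n U₀) c *
            chainMap (expMeanLogSU (n := Fin N)) n U₀ (centralBond c) (U₀ (iterCentralBond n (centralBond c))) *
            post (Averaging.iter (fun i => BlockAveraging.blockAvg (P := P) (j := i) (expMeanLogSU (n := Fin N))) n U₀) c) i) < α := fun i => by
        rw [chainMap_self, ← congrFun (loopHol_update_centralBond_self (by omega) _ c _) i, update_eq_self]
        exact hstrict n (lt_add_one n) c i
      have h2 : ∀ᶠ q : GaugeField P 0 (SU N) × SU N in 𝓝 (U₀, U₀ (iterCentralBond n (centralBond c))),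
          chainMap (expMeanLogSU (n := Fin N)) n q.1 (centralBond c) q.2 ∈
            centralWindowSet (Averaging.iter (fun i => BlockAveraging.blockAvg (P := P) (j := i) (expMeanLogSU (n := Fin N))) n q.1) c α := by
        have h3 : ∀ i : Idx P, ∀ᶠ q : GaugeField P 0 (SU N) × SU N in 𝓝 (U₀, U₀ (iterCentralBond n (centralBond c))), dist1 (fibreFamily
            (Averaging.iter (fun i => BlockAveraging.blockAvg (P := P) (j := i) (expMeanLogSU (n := Fin N))) n q.1) c
            (pre (Averaging.iter (fun i => BlockAveraging.blockAvg (P := P) (j := i) (expMeanLogSU (n := Fin N))) n q.1) c *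
              chainMap (expMeanLogSU (n := Fin N)) n q.1 (centralBond c) q.2 *
              post (Averaging.iter (fun i => BlockAveraging.blockAvg (P := P) (j := i) (expMeanLogSU (n := Fin N))) n q.1) c) i) < α := by
          intro i
          have hf := ((B12ContinuousTransportInvarianceOn.continuous_dist1_SU (N := N)).comp (continuous_fibreFamily₂ c i)).continuousAt.comp hstep
          exact hf.eventually (Iio_mem_nhds (hval i))
        filter_upwards [eventually_all.2 h3] with q hq
        exact fun i => (hq i).le
      have hEq : {q : GaugeField P 0 (SU N) × SU N | q.2 ∈ chainWindow (N := N) α (n + 1) q.1 c} =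
          {q : GaugeField P 0 (SU N) × SU N | q.2 ∈ chainWindow (N := N) α n q.1 (centralBond c)} ∩
            {q : GaugeField P 0 (SU N) × SU N | chainMap (expMeanLogSU (n := Fin N)) n q.1 (centralBond c) q.2 ∈
              centralWindowSet (Averaging.iter (fun i => BlockAveraging.blockAvg (P := P) (j := i) (expMeanLogSU (n := Fin N))) n q.1) c α} := by
        ext q
        rw [mem_setOf_eq, chainWindow_succ]
        rfl
      rw [hEq]
      exact Filter.inter_mem IH h2

/-- ★★ **THE WINDOW GRAPH OVER ITS OWN AVERAGE IS A NEIGHBOURHOOD OF A STRICT FIELD**: for `U₀` with strict small loop history below `n`, `{z | ∀ c, (Ū⁽ⁿ⁾ U₀) c ∈ T c z}`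
is a neighbourhood of `U₀` — parametric open mapping ✓`map_nhds_iterExtend_eq` on the window-graph neighbourhood of `(U₀, U₀ ∘ βₙ)`, then recognition.
[cite: Balaban1987RG1, (0.4) p.253 and (2.10) p.267; Balaban1985Averaging, Prop. 3 (124) p.36] -/
theorem graph_mem_nhds {α : ℝ} (hα24 : α ≤ 1 / 24) (hαδ : α < deltaSU (Fin N)) (hαL : 157 * α < ((P.L : ℝ) ^ (P.d - 1))⁻¹) {n : ℕ} (hn : n ≤ P.m + P.K)
    {Jac : GaugeField P n (SU N) × GaugeField P 0 (SU N) → ℝ≥0} {Φ : GaugeField P n (SU N) × GaugeField P 0 (SU N) → GaugeField P 0 (SU N)}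
    {T : PBond P n → GaugeField P 0 (SU N) → Set (SU N)}
    (hJT : ∀ V z, Jac (V, z) ≠ 0 ↔ ∀ c, V c ∈ T c z)
    (hrecog : ∀ V z (g : PBond P n → SU N), (∀ c, g c ∈ chainWindow (N := N) α n z c) →
        (∀ c, V c = Averaging.iter (fun i => BlockAveraging.blockAvg (P := P) (j := i) (expMeanLogSU (n := Fin N))) n
          (extend (iterCentralBond n) g z) c) →
        Jac (V, z) ≠ 0 ∧ Φ (V, z) = extend (iterCentralBond n) g z)
    (U₀ : GaugeField P 0 (SU N))
    (hstrict : ∀ k, k < n → ∀ (c' : PBond P (k + 1)) (i : Idx P),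
      dist1 (loopHol (Averaging.iter (fun i => BlockAveraging.blockAvg (P := P) (j := i) (expMeanLogSU (n := Fin N))) k U₀) c' i) < α) :
    {z : GaugeField P 0 (SU N) | ∀ c, Averaging.iter (fun i => BlockAveraging.blockAvg (P := P) (j := i) (expMeanLogSU (n := Fin N))) n U₀ c ∈ T c z}
      ∈ 𝓝 U₀ := by
  -- the window graph over all pivots is a neighbourhood of `(U₀, U₀ ∘ βₙ)`
  have hS : {q : GaugeField P 0 (SU N) × (PBond P n → SU N) | ∀ c, q.2 c ∈ chainWindow (N := N) α n q.1 c} ∈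
      𝓝 ((U₀, U₀ ∘ iterCentralBond n) : GaugeField P 0 (SU N) × (PBond P n → SU N)) := by
    have h : ∀ c, ∀ᶠ q : GaugeField P 0 (SU N) × (PBond P n → SU N) in 𝓝 (U₀, U₀ ∘ iterCentralBond n), q.2 c ∈ chainWindow (N := N) α n q.1 c := by
      intro c
      have hcont : Continuous fun q : GaugeField P 0 (SU N) × (PBond P n → SU N) => ((q.1, q.2 c) : GaugeField P 0 (SU N) × SU N) :=
        continuous_fst.prodMk ((continuous_apply c).comp continuous_snd)
      exact ContinuousAt.preimage_mem_nhds (f := fun q : GaugeField P 0 (SU N) × (PBond P n → SU N) => ((q.1, q.2 c) : GaugeField P 0 (SU N) × SU N))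
        (x := ((U₀, U₀ ∘ iterCentralBond n) : GaugeField P 0 (SU N) × (PBond P n → SU N))) hcont.continuousAt
        (chainWindow_mem_nhds (P := P) (N := N) hαδ hn c U₀ hstrict)
    exact eventually_all.2 h
  -- its image under `(z, g) ↦ (z, Ū⁽ⁿ⁾(z[βₙ ↦ g]))` is a neighbourhood of `(U₀, Ū⁽ⁿ⁾ U₀)`
  have hmap := map_nhds_iterExtend_eq (N := N) (fun P n => iterCentralBond (P := P) n) (fun _ _ => rfl) (fun _ _ _ => rfl) hα24 hαδ hαL hn U₀
    fun k hk c' i => (hstrict k hk c' i).le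
  have himg : (fun q : GaugeField P 0 (SU N) × (PBond P n → SU N) =>
      ((q.1, Averaging.iter (fun i => BlockAveraging.blockAvg (P := P) (j := i) (expMeanLogSU (n := Fin N))) n (extend (iterCentralBond n) q.2 q.1)) :
        GaugeField P 0 (SU N) × GaugeField P n (SU N))) '' {q | ∀ c, q.2 c ∈ chainWindow (N := N) α n q.1 c} ∈
      𝓝 ((U₀, Averaging.iter (fun i => BlockAveraging.blockAvg (P := P) (j := i) (expMeanLogSU (n := Fin N))) n U₀) :
        GaugeField P 0 (SU N) × GaugeField P n (SU N)) := by
    rw [← hmap]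
    exact image_mem_map hS
  -- pull back along `z ↦ (z, Ū⁽ⁿ⁾ U₀)` and recognise
  have hpull := (continuous_id.prodMk continuous_const :
    Continuous fun z : GaugeField P 0 (SU N) => ((z, Averaging.iter (fun i => BlockAveraging.blockAvg (P := P) (j := i) (expMeanLogSU (n := Fin N))) n U₀) :
      GaugeField P 0 (SU N) × GaugeField P n (SU N))).continuousAt.preimage_mem_nhds himg
  refine Filter.mem_of_superset hpull ?_
  rintro z ⟨q, hq, hqz⟩
  obtain ⟨hz, hA⟩ := Prod.mk.inj hqz
  subst hz
  exact (hJT _ _).1 (hrecog _ q.1 q.2 hq fun c => by rw [← hA]).1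

end Summit.QuantumFields.YangMills.Theorems.FluctuationComparisonRegPrIntLS2BetaChartContCarrierNhds

end
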